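import Mathlib
import HarnessLib.Audit
import Summits.PneNP.PneNP.Theorems.PstarNorUnitBridge
import Summits.PneNP.PneNP.Theorems.PstarLitNorCoreProof

/-!
# All chords NOR-forced ⟹ the core is a `LitNorStructure` with at most five outputs (ROUND-24, memo §9 R8 → R9)

FRONTIER range-avoidance ladder, rung F-N3, ROUND 24 (cell `pnp-ideate`, planner memo `r24/CORE-BOUND-NOTES.md` §9 R8/R9; restricted-model proof
complexity — nothing here bears on `P` versus `NP`).

The R8 → R9 link of the CoreShape chain.  Input: bridge data `B` (pnp-ideate-prover-2's `PstarChordBridge.BridgeData`, well-formed) for an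
XOR-closed core `J₀` with at least one chord, whose fundamental sets COVER the non-chords (`∀ j ∈ J₀ ∖ N, ∃ e ∈ N, j ∈ D e` — true for the
co-tree of a spanning forest of a bridgeless core), pendants `G₂` off the core, and FOR EVERY CHORD `e ∈ N` the NOR disjunct of
`PstarChordBridgeForcing.forced_chord_cases_sys` (verbatim shape, constants arbitrary).  Output (`card_le_five_of_all_nor`): `#J₀ ≤ 5`.

Route: by `PstarNorUnitBridge.nor_unit_of_bridge` each `D e` is a CONS-T pair `(σ_e, ·)(τ_e, ·)` with a gadget `(σ_e, τ_e)`; by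
`lit_iff_of_bridge` the pair `{σ_e, τ_e}` is the set of shift-sensitive coordinates of the second constraint, hence ONE pair `{σ, τ}` for all
chords; every non-chord is then a literal edge, the gadget `g₀` lies outside `J₀` (inside, it would be a member of some `D e′` carrying both
literals, against the disjointness of that pair's AND pairs), and each chord closes the XOR triangle on its pair (`litAdj_path`, from the
parity condition `D e + e` even) — i.e. `PstarLitNorCore.LitNorStructure I J₀ σ τ g₀`, and `PstarLitNorCoreProof.litNorCoreBound` bounds it by `5`.
-/

set_option linter.dupNamespace false -- `Summit.PneNP.PneNP.…`: summit = sub-problem name (D-0017 single-conjunct layout)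

open Finset Module Literature.Computability.Complexity
open Summit.PneNP.PneNP.Theorems.PstarSALevel (varSet bdry BoundaryExpanding SimpleOverlap)
open Summit.PneNP.PneNP.Theorems.PstarGapLinearised (andPair andPair_subset_varSet)
open Summit.PneNP.PneNP.Theorems.PstarChordEndgameTools (mem_andPair_iff)
open Summit.PneNP.PneNP.Theorems.PstarXCore (xpair mem_xpair)
open Summit.PneNP.PneNP.Theorems.PstarChordRepair (IsChord)
open Summit.PneNP.PneNP.Theorems.PstarCoreBound (XorClosed)
open Summit.PneNP.PneNP.Theorems.PstarCubeIdeals (IsAffineFn)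
open Summit.PneNP.PneNP.Theorems.PstarProductRank (qform)
open Summit.PneNP.PneNP.Theorems.PstarLitNorCore (LitEdge LitAdj LitNorStructure)
open Summit.PneNP.PneNP.Theorems.PstarLitNorCoreProof (litNorCoreBound)
open Summit.PneNP.PneNP.Theorems.PstarChordBridgeTools (xpdeg)
open Summit.PneNP.PneNP.Theorems.PstarChordBridge (BridgeData sys)
open Summit.PneNP.PneNP.Theorems.PstarChordBridgeFundamental (xpdeg_insert odd_of_end exists_mem_of_odd false_of_both_ends)
open Summit.PneNP.PneNP.Theorems.PstarChordBridgeForcing (freeMon freePolar gam)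
open Summit.PneNP.PneNP.Theorems.PstarNorUnitBridge (nor_unit_of_bridge lit_iff_of_bridge)

namespace Summit.PneNP.PneNP.Theorems.PstarNorUnitAssembly

variable {n m : ℕ}

/-! ## The XOR triangle of a chord with a two-element fundamental set -/

/-- Slot-degree of the empty family. -/
theorem xpdeg_empty (I : LocalMap 4 n m) (w : Fin n) : xpdeg I ∅ w = 0 := by
  unfold PstarChordBridgeTools.xpdeg PstarXorElimination.pdeg
  simp

/-- The slot-degree of `w` in a single output is `1` if `w` is one of its XOR variables (pure: the two XOR slots differ). -/
theorem xpdeg_singleton_of_mem (I : LocalMap 4 n m) (hI : I.IsPure xorAndPred) {j : Fin m} {w : Fin n} (hw : w ∈ xpair I j) :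
    xpdeg I {j} w = 1 := by
  have h01 : I.vars j 0 ≠ I.vars j 1 := fun h => absurd (hI.2 j h) (by decide)
  have h : xpdeg I (insert j ∅) w = xpdeg I ∅ w + (if I.vars j 0 = w then 1 else 0) + (if I.vars j 1 = w then 1 else 0) :=
    xpdeg_insert I (notMem_empty j) w
  rw [insert_empty_eq] at h
  rw [h, xpdeg_empty]
  rcases (mem_xpair I).1 hw with rfl | rfl
  · rw [if_pos rfl, if_neg (Ne.symm h01)]
  · rw [if_neg h01, if_pos rfl]

/-- **The literal path of a NOR chord.**  If `D + j` is everywhere even with `D = {ja, jb}`, `j ∉ D`, `ja ≠ jb`, the ends of `j` in `ja`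
resp. `jb`, and `ja, jb ∈ J₀` are literal edges, then the XOR pair of `j` is joined by a literal path (through the common vertex of `ja, jb`). -/
theorem litAdj_path (I : LocalMap 4 n m) (hI : I.IsPure xorAndPred) (hS : SimpleOverlap I) {J₀ : Finset (Fin m)} {σ τ : Fin n}
    {j ja jb : Fin m} (hab : ja ≠ jb) (hj : j ∉ ({ja, jb} : Finset (Fin m)))
    (heven : ∀ w, Even (xpdeg I (insert j {ja, jb}) w)) (hJa : ja ∈ J₀) (hJb : jb ∈ J₀) (hLa : LitEdge I σ τ ja)
    (hLb : LitEdge I σ τ jb) (hu : I.vars j 0 ∈ xpair I ja) (hv : I.vars j 1 ∈ xpair I jb) :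
    Relation.ReflTransGen (LitAdj I J₀ σ τ) (I.vars j 0) (I.vars j 1) := by
  classical
  have hja : j ≠ ja := fun h => hj (h ▸ mem_insert_self _ _)
  have hjb : j ≠ jb := fun h => hj (h ▸ mem_insert_of_mem (mem_singleton_self _))
  have ha01 : I.vars ja 0 ≠ I.vars ja 1 := fun h => absurd (hI.2 ja h) (by decide)
  -- the other end `w` of `ja`
  obtain ⟨w, hwa, hwu, hxa⟩ : ∃ w, w ∈ xpair I ja ∧ w ≠ I.vars j 0 ∧
      ((I.vars ja 0 = I.vars j 0 ∧ I.vars ja 1 = w) ∨ (I.vars ja 0 = w ∧ I.vars ja 1 = I.vars j 0)) := by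
    rcases (mem_xpair I).1 hu with h | h
    · exact ⟨I.vars ja 1, (mem_xpair I).2 (Or.inr rfl), fun e => ha01 (h.symm.trans e.symm), Or.inl ⟨h.symm, rfl⟩⟩
    · exact ⟨I.vars ja 0, (mem_xpair I).2 (Or.inl rfl), fun e => ha01 (e.trans h), Or.inr ⟨rfl, h.symm⟩⟩
  -- `w` is not the other end of `j` (else `ja` holds both ends of `j`)
  have hwv : w ≠ I.vars j 1 := fun h => false_of_both_ends I hI hS hja.symm hu (h ▸ hwa)
  -- evenness at `w`: `w` lies on `jb` too
  have hwb : w ∈ xpair I jb := by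
    have h := heven w
    rw [xpdeg_insert I hj, if_neg hwu.symm, if_neg hwv.symm, add_zero, add_zero] at h
    have hnot : ja ∉ ({jb} : Finset (Fin m)) := fun h' => hab (mem_singleton.1 h')
    have h2 : xpdeg I (insert ja {jb}) w = xpdeg I {jb} w + (if I.vars ja 0 = w then 1 else 0) + (if I.vars ja 1 = w then 1 else 0) :=
      xpdeg_insert I hnot w
    rw [h2] at h
    have hone : (if I.vars ja 0 = w then 1 else 0) + (if I.vars ja 1 = w then 1 else 0) = 1 := by
      rcases hxa with ⟨h0, h1⟩ | ⟨h0, h1⟩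
      · rw [if_neg (fun e => hwu (e.symm.trans h0)), if_pos h1]
      · rw [if_pos h0, if_neg (fun e => ha01 (h0.trans e.symm))]
    by_contra hnb
    have hb0 : xpdeg I {jb} w = 0 := by
      unfold PstarChordBridgeTools.xpdeg PstarXorElimination.pdeg
      rw [card_eq_zero.2, card_eq_zero.2]
      · exact filter_eq_empty_iff.2 fun i hi e => hnb ((mem_singleton.1 hi) ▸ (mem_xpair I).2 (Or.inr e.symm))
      · exact filter_eq_empty_iff.2 fun i hi e => hnb ((mem_singleton.1 hi) ▸ (mem_xpair I).2 (Or.inl e.symm))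
    rw [hb0, zero_add, hone] at h
    exact Nat.not_even_one h
  -- two literal steps: `j.0 ~ w` through `ja`, `w ~ j.1` through `jb`
  have hb01 : I.vars jb 0 ≠ I.vars jb 1 := fun h => absurd (hI.2 jb h) (by decide)
  have step1 : LitAdj I J₀ σ τ (I.vars j 0) w := ⟨ja, hJa, hLa, hxa⟩
  have step2 : LitAdj I J₀ σ τ w (I.vars j 1) := by
    refine ⟨jb, hJb, hLb, ?_⟩
    rcases (mem_xpair I).1 hwb with h | h <;> rcases (mem_xpair I).1 hv with h' | h'
    · exact absurd (h.trans h'.symm) hwv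
    · exact Or.inl ⟨h.symm, h'.symm⟩
    · exact Or.inr ⟨h'.symm, h.symm⟩
    · exact absurd (h.trans h'.symm) hwv
  exact (Relation.ReflTransGen.single step1).tail step2

/-! ## The assembly -/

/-- **All chords NOR-forced ⟹ `#J₀ ≤ 5`.**  See the module docstring for the hypotheses. -/
theorem card_le_five_of_all_nor (I : LocalMap 4 n m) (hI : I.IsPure xorAndPred) (hS : SimpleOverlap I) {r : ℕ}
    (hB : BoundaryExpanding r I) {B : BridgeData n m} (hW : B.WF I) (hr : (B.J₀ ∪ B.G₂).card ≤ r) (hJr : B.J₀.card < r)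
    (hX : XorClosed I B.J₀) (hG₂ : Disjoint B.G₂ B.J₀) (hN : B.N.Nonempty) (hcover : ∀ j ∈ B.J₀ \ B.N, ∃ e ∈ B.N, j ∈ B.D e)
    (hNOR : ∀ e ∈ B.N, ∃ a b : Fin n → ZMod 2, ∃ β α : ZMod 2, ∃ m₁ m₂ : (Fin n → ZMod 2) → ZMod 2,
      freePolar I B.N B.T₂ B.G₂ a b = 1 ∧
      (∀ x, ((sys I B).F x).2 + (sys I B).t.2 = (freePolar I B.N B.T₂ B.G₂ x b + β) * (freePolar I B.N B.T₂ B.G₂ x a + α) + 1) ∧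
      IsAffineFn m₁ ∧ IsAffineFn m₂ ∧
      ∀ x, qform (B.D e) (fun j => I.vars j 2) (fun j => I.vars j 3) x + (gam B e + 1) =
        (freePolar I B.N B.T₂ B.G₂ x b + β + 1) * m₁ x + (freePolar I B.N B.T₂ B.G₂ x a + α + 1) * m₂ x) :
    B.J₀.card ≤ 5 := by
  classical
  -- shift-sensitivity: the chord-independent literal predicate
  set Lit : Fin n → Prop := fun v => ∃ x, ((sys I B).F (x + Pi.single v 1)).2 + (sys I B).t.2 ≠ ((sys I B).F x).2 + (sys I B).t.2
    with hLit
  have heG : ∀ e ∈ B.N, e ∉ B.G₂ := fun e he h => Finset.disjoint_left.1 hG₂ h (hW.hN he)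
  -- per-chord structure
  have unit : ∀ e ∈ B.N, ∃ j₁ j₂ : Fin m, ∃ σ τ : Fin n, j₁ ≠ j₂ ∧ B.D e = {j₁, j₂} ∧ Disjoint (andPair I j₁) (andPair I j₂) ∧
      σ ∈ andPair I j₁ ∧ τ ∈ andPair I j₂ ∧ (∀ v, Lit v ↔ (v = σ ∨ v = τ)) ∧
      ∃ g ∈ B.T₂ ∪ freeMon I B.N B.G₂, σ ∈ andPair I g ∧ τ ∈ andPair I g := by
    intro e he
    obtain ⟨a, b, β, α, m₁, m₂, hab, hq, hm₁, hm₂, hQ⟩ := hNOR e he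
    obtain ⟨j₁, j₂, σ, τ, hne, hD, hdisj, hσ, hτ, hlit, hg⟩ :=
      nor_unit_of_bridge I hI hS hB hW hr he (heG e he) hq hm₁ hm₂ hQ
    refine ⟨j₁, j₂, σ, τ, hne, hD, hdisj, hσ, hτ, fun v => ?_, hg⟩
    rw [← hlit v]
    exact (lit_iff_of_bridge I B hab hq v).symm
  -- fix one chord and its literal pair
  obtain ⟨e₀, he₀⟩ := hN
  obtain ⟨i₁, i₂, σ, τ, hine, hD₀, hdisj₀, hσ₀, hτ₀, hlit₀, g₀, hg₀, hσg, hτg⟩ := unit e₀ he₀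
  have hστ : σ ≠ τ := fun h => Finset.disjoint_left.1 hdisj₀ hσ₀ (h ▸ hτ₀)
  -- every chord's pair is `{σ, τ}`; its fundamental set consists of two literal edges, none carrying both literals
  have chord : ∀ e ∈ B.N, ∃ j₁ j₂ : Fin m, j₁ ≠ j₂ ∧ B.D e = {j₁, j₂} ∧ LitEdge I σ τ j₁ ∧ LitEdge I σ τ j₂ ∧
      ¬ (σ ∈ andPair I j₁ ∧ τ ∈ andPair I j₁) ∧ ¬ (σ ∈ andPair I j₂ ∧ τ ∈ andPair I j₂) := by
    intro e he
    obtain ⟨j₁, j₂, σ', τ', hne, hD, hdisj, hσ', hτ', hlit', -⟩ := unit e he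
    -- `{σ', τ'} = {σ, τ}`
    have h1 : σ' = σ ∨ σ' = τ := (hlit₀ σ').1 ((hlit' σ').2 (Or.inl rfl))
    have h2 : τ' = σ ∨ τ' = τ := (hlit₀ τ').1 ((hlit' τ').2 (Or.inr rfl))
    have h3 : σ = σ' ∨ σ = τ' := (hlit' σ).1 ((hlit₀ σ).2 (Or.inl rfl))
    have h4 : τ = σ' ∨ τ = τ' := (hlit' τ).1 ((hlit₀ τ).2 (Or.inr rfl))
    have hσ'τ' : σ' ≠ τ' := fun h => Finset.disjoint_left.1 hdisj hσ' (h ▸ hτ')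
    have litEdge_of : ∀ {j : Fin m} {ρ : Fin n}, ρ ∈ andPair I j → (ρ = σ ∨ ρ = τ) → LitEdge I σ τ j := by
      intro j ρ hρ hρ'
      unfold PstarLitNorCore.LitEdge
      rcases (mem_andPair_iff I j ρ).1 hρ with h | h <;> rcases hρ' with rfl | rfl
      · exact Or.inl h.symm
      · exact Or.inr (Or.inl h.symm)
      · exact Or.inr (Or.inr (Or.inl h.symm))
      · exact Or.inr (Or.inr (Or.inr h.symm))
    have both : ∀ {j j' : Fin m} {ρ ρ' : Fin n}, Disjoint (andPair I j) (andPair I j') → ρ ∈ andPair I j → ρ' ∈ andPair I j' →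
        (ρ = σ ∨ ρ = τ) → (ρ' = σ ∨ ρ' = τ) → ρ ≠ ρ' → ¬ (σ ∈ andPair I j ∧ τ ∈ andPair I j) := by
      intro j j' ρ ρ' hdj hρ hρ' h h' hρρ' hboth
      -- `ρ' ∈ {σ, τ} ⊆ andPair j`, but `ρ' ∈ andPair j'`
      have : ρ' ∈ andPair I j := by rcases h' with rfl | rfl; exacts [hboth.1, hboth.2]
      exact Finset.disjoint_left.1 hdj this hρ'
    refine ⟨j₁, j₂, hne, hD, litEdge_of hσ' h1, litEdge_of hτ' h2, both hdisj hσ' hτ' h1 h2 hσ'τ', ?_⟩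
    exact both hdisj.symm hτ' hσ' h2 h1 hσ'τ'.symm
  -- every non-chord is a literal edge carrying not both literals
  have nonchord : ∀ j ∈ B.J₀ \ B.N, LitEdge I σ τ j ∧ ¬ (σ ∈ andPair I j ∧ τ ∈ andPair I j) := by
    intro j hj
    obtain ⟨e, he, hje⟩ := hcover j hj
    obtain ⟨j₁, j₂, -, hD, hL₁, hL₂, hb₁, hb₂⟩ := chord e he
    rw [hD, mem_insert, mem_singleton] at hje
    rcases hje with rfl | rfl
    · exact ⟨hL₁, hb₁⟩
    · exact ⟨hL₂, hb₂⟩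
  -- the gadget lies outside the core
  have hg₀J : g₀ ∉ B.J₀ := by
    intro hJ
    rcases mem_union.1 hg₀ with h | h
    · exact (nonchord g₀ (hW.hT₂ h)).2 ⟨hσg, hτg⟩
    · exact Finset.disjoint_left.1 hG₂ (mem_filter.1 h).1 hJ
  have hg₀pair : (I.vars g₀ 2 = σ ∧ I.vars g₀ 3 = τ) ∨ (I.vars g₀ 2 = τ ∧ I.vars g₀ 3 = σ) := by
    rcases (mem_andPair_iff I g₀ σ).1 hσg with h | h <;> rcases (mem_andPair_iff I g₀ τ).1 hτg with h' | h'
    · exact absurd (h.trans h'.symm) hστ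
    · exact Or.inl ⟨h.symm, h'.symm⟩
    · exact Or.inr ⟨h'.symm, h.symm⟩
    · exact absurd (h.trans h'.symm) hστ
  -- the `LitNorStructure`
  have hLNS : LitNorStructure I B.J₀ σ τ g₀ := by
    refine ⟨hστ, hg₀J, hg₀pair, fun j hj hnl => ?_⟩
    by_cases hjN : j ∈ B.N
    · refine ⟨hW.hchord j hjN, ?_⟩
      obtain ⟨j₁, j₂, hne, hD, hL₁, hL₂, -, -⟩ := chord j hjN
      have hjD : j ∉ ({j₁, j₂} : Finset (Fin m)) := fun h => (mem_sdiff.1 (hW.hD j hjN (hD ▸ h))).2 hjN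
      have heven : ∀ w, Even (xpdeg I (insert j {j₁, j₂}) w) := by rw [← hD]; exact hW.hDeven j hjN
      have hJ₁ : j₁ ∈ B.J₀ := (mem_sdiff.1 (hW.hD j hjN (hD ▸ mem_insert_self _ _))).1
      have hJ₂ : j₂ ∈ B.J₀ := (mem_sdiff.1 (hW.hD j hjN (hD ▸ mem_insert_of_mem (mem_singleton_self _)))).1
      -- the ends of `j` lie on `j₁`, `j₂` (odd vertices of `D j`), one on each
      have hend : ∀ {s : Fin 4}, s.val < 2 → I.vars j s ∈ xpair I j₁ ∨ I.vars j s ∈ xpair I j₂ := by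
        intro s hs
        obtain ⟨i, hi, hmem⟩ := exists_mem_of_odd I (odd_of_end I hI hjD heven hs)
        rw [mem_insert, mem_singleton] at hi
        rcases hi with rfl | rfl
        · exact Or.inl hmem
        · exact Or.inr hmem
      have hj₁ne : j₁ ≠ j := fun h => hjD (h ▸ mem_insert_self _ _)
      have hj₂ne : j₂ ≠ j := fun h => hjD (h ▸ mem_insert_of_mem (mem_singleton_self _))
      rcases hend (s := 0) (by decide) with h0 | h0 <;> rcases hend (s := 1) (by decide) with h1 | h1
      · exact absurd (false_of_both_ends I hI hS hj₁ne h0 h1) id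
      · exact litAdj_path I hI hS hne hjD heven hJ₁ hJ₂ hL₁ hL₂ h0 h1
      · have heven' : ∀ w, Even (xpdeg I (insert j {j₂, j₁}) w) := by rw [pair_comm]; exact heven
        have hjD' : j ∉ ({j₂, j₁} : Finset (Fin m)) := by rw [pair_comm]; exact hjD
        exact litAdj_path I hI hS hne.symm hjD' heven' hJ₂ hJ₁ hL₂ hL₁ h0 h1
      · exact absurd (false_of_both_ends I hI hS hj₂ne h0 h1) id
    · exact absurd (nonchord j (mem_sdiff.2 ⟨hj, hjN⟩)).1 hnl
  exact litNorCoreBound n m r I hI hB hS B.J₀ σ τ g₀ hJr hX hLNS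

end Summit.PneNP.PneNP.Theorems.PstarNorUnitAssembly
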